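import Summits.QuantumFields.YangMills.Theorems.UnitScaleTiltProp7ExactCorrectorHNReality
import Summits.QuantumFields.YangMills.Theorems.UnitScaleTiltProp7ExactCorrectorSliceReading
import Summits.QuantumFields.YangMills.Theorems.UnitScaleTiltProp7FibrePointOfPinnedRegauge
import Summits.QuantumFields.YangMills.Theorems.UnitScaleTiltProp7FlatHolonomy
import Literature.Analysis.Complex.RungeUnits
import HarnessLib

/-!
# Route `UnitScaleTilt`, crux K1 «MinimiserStabilityRegPr» (stmt-QuantumFields-19200), route-R E′ path (α′): THE (E1-e) KNIT — the (E1) conjunct «PINNED SLICE THEOREM» of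
# ✓ `Prop7PV3EOfPinnedSliceAndZetaRow.stub_PV3E_of_pinnedSliceAndZetaRow`, PER MEMBER AND COMPETITOR, from the exact corrector (✓ `exists_exact_corrector_member'`), the
# (E1-c)→(E1-e) junction (✓p678611, ✓p679272), the slice reading (✓p672939) and STEP 3 of the (α′) knit (✓ `fibrePoint_rows_of_pinned_regauge`) — modulo EXACTLY the displayed rows:
# the untwisted representative `X` of the competitor with its chart rows, the corrector's analytic rows (hK),(hK₂), and the numeric windows

Cell `ym3-torus`, width seat `ym3-torus-px13` (gen 3); ★p1 g16 NAMER WORD 8 (2026-08-28T23:49Z) «px13: (E1-e) KNIT GO»; LOCATE = bus 23:52Z (letters: `c := +I`, `u := e^{Iψ}`, px15's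
weight letter, `q := max (ℓ‖·‖) (ℓ²‖D*_𝒰·‖)`).  THEOREMS ONLY (0 `def`, 0 `sorry`, 0 `instance`); `--supports stmt-QuantumFields-19200`, count-neutral.  YM₃ on T³ is a ladder rung (R3),
not the Clay problem; nothing here claims the stub, the crux, d = 4 or the gap.

WHAT IS PROVED (ns `…Theorems.Prop7PinnedSliceOfExactCorrector`; run `K`, `n ≤ K`, `SU(2)` fields `W X` on the finest torus, `𝒰 := fun κ z => unitsField (toUField W) ⟨z, κ⟩`, `ℓ := L^{K−n}`).
* §1 letters: `slice_smul` (the `S_H` clause is `ℂ`-linear), `hermitian_traceless_negI_smul`, `descTransf_eq_one_of_vanish` (a gauge transformation equal to `1` on the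
  `(K−n)`-centres descends to `1`); the product form `↑(Y_b W_b⁻¹) = e^{Iψ(z)}·E·(R(𝒰)e^{Iψ(z+κ)})^*` for `Y = X^{u}` is proved inline in §2.
* §2 ★★★ `pinnedSlice_member` — GIVEN: `X ∈ (6)(e) ∩ 𝔅_k(V)` with `A(W′) = A(X)`; the chart data `E_μ(y) := ↑(X_b W_b⁻¹)` with `‖E − 1‖ < 1`, `ℓ‖mlog E‖ ≤ s`, `ℓ²‖D*_𝒰(mlog∘E)‖ ≤ s`,
  `40s ≤ ℓ`; the rows (hK),(hK₂) for every characterised linear corrector `(I, L)` (constants `c_I, c₂ ≥ 0`); the windows `1200·C_L·s ≤ 1` and `C_L·1600·(7C_L s + s) ≤ 1∕2`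
  (`C_L := max (3c_I∕2) (max c_I c₂)`) — THEN `∃ Y ∈ (6)(e) ∩ 𝔅_k(V)` with `A(W′) = A(Y)`, `‖↑(Y_bW_b⁻¹) − 1‖ ≤ (2s + 6·C_L·s)·ℓ⁻¹` on every bond, and the EXACT `S_H` clause
  `Δ_𝒰(D*_𝒰(I•((−I)•mlog ↑(Y_bW_b⁻¹))))(x) = 0` for every `x ∉ range (embIter (K−n))` — the (E1) conjunct's body VERBATIM with `sQ := 2s + 6C_L s`.
HONEST SCOPE.  Assembly; displayed remain the competitor's representative + chart rows (the Thm-2∕(U2)∕(F1′) lineage: ✓ `Prop7SmoothUntwistDatum.exists_datum_of_smoothUntwist_T3` (w1 g12) is the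
located inhabitant), the corrector's analytic rows (★routeR-w3 g6's (E1-b) chain), and the windows (★p1's constants).  Constants generous.

References: T. Bałaban, CMP 102 (1985) 277–309 [Balaban1985Variational] ((4)–(7) p.278, Prop. 7 p.299, (141)–(143)); CMP 99 (1985) 75–102 [Balaban1985RegularSpaces] ((1.14) p.78,
(1.36) p.82); CMP 98 (1985) 17–51 [Balaban1985Averaging] ((8)–(11) p.19, (22)–(23) p.21); CMP 99 (1985) 389–434 [Balaban1985BackgroundPropagators] ((3.3) p.390, (3.8) p.392).
-/

set_option autoImplicit false

noncomputable section

open scoped BigOperators Matrix.Norms.L2Operator Matrix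
open NormedSpace

namespace Summit.QuantumFields.YangMills.Theorems.Prop7PinnedSliceOfExactCorrector

open Literature.MathematicalPhysics.QuantumFieldTheory.Balaban1983to89
open Literature.MathematicalPhysics.QuantumFieldTheory.Balaban1983to89.T3ContinuumYM3Torus
open Literature.MathematicalPhysics.QuantumFieldTheory.Balaban1983to89.T3PrintedRegularMinimiser (regFibrePr)
open Literature.MathematicalPhysics.QuantumFieldTheory.Balaban1983to89.T3PrintedRegularOrbits (descTransf)
open T4Continuum
open MatrixLog (mlog)
open B9Eq39Adjoint (R R_def R_sub R_apply_one covD divB)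
open B9TorusCalculus (torusT)
open B15DeterminingSets (embIter)
open B10Eq27TorusAxialLog (unitsField toUField)
open BlockAveragingEMLLinearisedBackground (pertVar)
open Summit.QuantumFields.YangMills.Theorems.Prop7ExactCorrectorHNMember (exists_torusPotential norm_R_eq star_R_eq hN0_member hN_member T₂_sub norm_T₂_le exp_half_le_two)
open Summit.QuantumFields.YangMills.Theorems.Prop7ExactCorrectorHNReality (skew_traceless_mlog_chartArg hNreal_member_row su_unitary)
open Summit.QuantumFields.YangMills.Theorems.Prop7ExactCorrectorMember (exists_exact_corrector_member')
open Summit.QuantumFields.YangMills.Theorems.Prop7GaugeRowsMaxSup (gauge_norm_le)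
open Summit.QuantumFields.YangMills.Theorems.Prop7ExactCorrectorGaugeSockets (unitsField_toUField_norm_le_one covD_field_sub)
open Summit.QuantumFields.YangMills.Theorems.Prop7CovHodgeSplit (unitsField_toUField_mem_unitary)
open Summit.QuantumFields.YangMills.Theorems.Prop7ChartRemainderZero (star_smul_of_hermitian star_I')
open Summit.QuantumFields.YangMills.Theorems.Prop7ExactCorrectorSliceReading (slice_of_fixedPoint_T3)
open Summit.QuantumFields.YangMills.Theorems.Prop7FibrePointOfPinnedRegauge (fibrePoint_rows_of_pinned_regauge)
open Summit.QuantumFields.YangMills.Theorems.Prop7FlatHolonomy (transfUp_eq_embIter)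

/-! ## §1 Letters -/

section Letters

variable {P : Params} {N : ℕ}

/-- The `S_H` clause is `ℂ`-linear: `Δ_U(D*_U(a•A)) = a•Δ_U(D*_U A)` pointwise. [cite: Balaban1985BackgroundPropagators, (3.8) p.392] -/
theorem slice_smul (U : Fin P.d → Site P 0 → (Matrix (Fin N) (Fin N) ℂ)ˣ) (a : ℂ) (A : Fin P.d → Site P 0 → Matrix (Fin N) (Fin N) ℂ) (x : Site P 0) :
    divB (torusT P 0) U (fun μ z => covD (torusT P 0) U μ (fun y => divB (torusT P 0) U (fun κ z => a • A κ z) y) z) x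
      = a • divB (torusT P 0) U (fun μ z => covD (torusT P 0) U μ (fun y => divB (torusT P 0) U A y) z) x := by
  have e1 : (fun y => divB (torusT P 0) U (fun κ z => a • A κ z) y) = a • (fun y => divB (torusT P 0) U A y) := by
    funext y; rw [Pi.smul_apply, B9Eq3117Current.divB_smul]
  have e2 : (fun μ z => covD (torusT P 0) U μ (fun y => divB (torusT P 0) U (fun κ z => a • A κ z) y) z)
      = fun μ z => a • covD (torusT P 0) U μ (fun y => divB (torusT P 0) U A y) z := by
    funext μ z; rw [e1, B9Eq39Adjoint.covD_smul]
  rw [e2, B9Eq3117Current.divB_smul]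

/-- `(−I)•M` is Hermitian and traceless when `M` is skew-Hermitian and traceless. [folklore] -/
theorem hermitian_traceless_negI_smul {M : Matrix (Fin N) (Fin N) ℂ} (hs : star M = -M) (ht : M.trace = 0) :
    ((-Complex.I) • M)ᴴ = (-Complex.I) • M ∧ ((-Complex.I) • M).trace = 0 := by
  refine ⟨?_, by rw [Matrix.trace_smul, ht, smul_zero]⟩
  rw [← Matrix.star_eq_conjTranspose, star_smul, star_neg, star_I', neg_neg, hs, smul_neg, neg_smul]

/-- A gauge transformation equal to `1` on the `(K−n)`-centres descends to the trivial one. [cite: Balaban1985Averaging, (11)-(12) p.19] -/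
theorem descTransf_eq_one_of_vanish (F : T3Family) {n K : ℕ} (h : n ≤ K) {G : Type*} [Group G] (u : GaugeTransf (F.P K) 0 G)
    (hu : ∀ y : Site (F.P K) (K - n), u (embIter (K - n) y) = 1) : descTransf F n K h u = fun _ => 1 := by
  funext x
  show transfUp u (K - n) _ = 1
  rw [transfUp_eq_embIter]
  exact hu _

end Letters

/-! ## §2 The pinned slice theorem per member and competitor -/

section Member

set_option maxHeartbeats 400000 in
/-- ★★★ **THE PINNED SLICE THEOREM (E1), PER MEMBER AND COMPETITOR, MODULO THE DISPLAYED ROWS.**  See the module docstring for the letters; the conclusion is the body of the (E1)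
conjunct of ✓ `stub_PV3E_of_pinnedSliceAndZetaRow` with `sQ := 2s + 6·C_L·s`, `C_L := max (3c_I∕2) (max c_I c₂)`.
[cite: Balaban1985Variational, Prop. 7 p.299, (4)-(7) p.278, (141)-(143) p.299; Balaban1985RegularSpaces, (1.14) p.78; Balaban1985Averaging, (11) p.19, (22)-(23) p.21] -/
theorem pinnedSlice_member (F : T3Family) {n K : ℕ} (h : n ≤ K) {e : ℝ} (he : 0 ≤ e)
    (V : GaugeField (F.P n) 0 (Matrix.specialUnitaryGroup (Fin 2) ℂ)) (W W' X : GaugeField (F.P K) 0 (Matrix.specialUnitaryGroup (Fin 2) ℂ))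
    -- the competitor's untwisted representative
    (hX : X ∈ regFibrePr F n K h e V) (hAX : wilsonAction4 W' = wilsonAction4 X)
    -- its chart rows
    {s : ℝ}
    (hE1 : ∀ (μ : Fin (F.P K).d) (y : Site (F.P K) 0), ‖((X ⟨y, μ⟩ * (W ⟨y, μ⟩)⁻¹ : Matrix.specialUnitaryGroup (Fin 2) ℂ) : Matrix (Fin 2) (Fin 2) ℂ) - 1‖ < 1)
    (hEβ : ∀ (μ : Fin (F.P K).d) (y : Site (F.P K) 0),
      (F.L : ℝ) ^ (K - n) * ‖mlog ((X ⟨y, μ⟩ * (W ⟨y, μ⟩)⁻¹ : Matrix.specialUnitaryGroup (Fin 2) ℂ) : Matrix (Fin 2) (Fin 2) ℂ)‖ ≤ s)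
    (hEdiv : ∀ x : Site (F.P K) 0, ((F.L : ℝ) ^ (K - n)) ^ 2 * ‖divB (torusT (F.P K) 0) (fun κ z => unitsField (toUField W) ⟨z, κ⟩)
      (fun μ y => mlog ((X ⟨y, μ⟩ * (W ⟨y, μ⟩)⁻¹ : Matrix.specialUnitaryGroup (Fin 2) ℂ) : Matrix (Fin 2) (Fin 2) ℂ)) x‖ ≤ s)
    (hs40 : 40 * s ≤ (F.L : ℝ) ^ (K - n))
    -- the torus potential letter of the weight (any `d` with the descent row)
    (d : Site (F.P K) 0 → ℕ)
    (hd : ∀ x : Site (F.P K) 0, x ∉ Set.range (embIter (K - n)) →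
      ∃ μ : Fin (F.P K).d, d (torusT (F.P K) 0 μ x) + 1 ≤ d x ∨ d ((torusT (F.P K) 0 μ).symm x) + 1 ≤ d x)
    -- the corrector's analytic rows, for every characterised (I, L)
    {cI c₂ : ℝ} (hcI : 0 ≤ cI) (hc₂ : 0 ≤ c₂)
    (hKrows : ∀ (I : (Site (F.P K) 0 → Matrix (Fin 2) (Fin 2) ℂ) →+ (Site (F.P K) 0 → Matrix (Fin 2) (Fin 2) ℂ))
        (L : (Fin (F.P K).d → Site (F.P K) 0 → Matrix (Fin 2) (Fin 2) ℂ) →+ (Site (F.P K) 0 → Matrix (Fin 2) (Fin 2) ℂ)),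
      (∀ A φ, (∀ x, divB (torusT (F.P K) 0) (fun κ z => unitsField (toUField W) ⟨z, κ⟩)
            (fun μ => covD (torusT (F.P K) 0) (fun κ z => unitsField (toUField W) ⟨z, κ⟩) μ φ) x
          = divB (torusT (F.P K) 0) (fun κ z => unitsField (toUField W) ⟨z, κ⟩) A x) → L A = φ - I φ) →
      (∀ (A) (y : Site (F.P K) (K - n)), L A (embIter (K - n) y) = 0) →
      (∀ φ, ∀ x : Site (F.P K) 0, x ∉ Set.range (embIter (K - n)) →
        divB (torusT (F.P K) 0) (fun κ z => unitsField (toUField W) ⟨z, κ⟩)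
          (fun μ => covD (torusT (F.P K) 0) (fun κ z => unitsField (toUField W) ⟨z, κ⟩) μ
            (fun y => divB (torusT (F.P K) 0) (fun κ z => unitsField (toUField W) ⟨z, κ⟩)
              (fun ν => covD (torusT (F.P K) 0) (fun κ z => unitsField (toUField W) ⟨z, κ⟩) ν (I φ)) y)) x = 0) →
      (∀ (A) (μ : Fin (F.P K).d) (x : Site (F.P K) 0),
          ‖covD (torusT (F.P K) 0) (fun κ z => unitsField (toUField W) ⟨z, κ⟩) μ (L A) x‖
            ≤ cI * (F.L : ℝ) ^ (K - n) * ‖(fun x => divB (torusT (F.P K) 0) (fun κ z => unitsField (toUField W) ⟨z, κ⟩) A x)‖) ∧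
      (∀ A, ‖(fun x => ((min (d x : ℝ) ((F.L : ℝ) ^ (K - n)) : ℝ) : ℂ) •
            divB (torusT (F.P K) 0) (fun κ z => unitsField (toUField W) ⟨z, κ⟩)
              (fun μ y => (-Complex.I) • covD (torusT (F.P K) 0) (fun κ z => unitsField (toUField W) ⟨z, κ⟩) μ (L A) y) x)‖
            ≤ c₂ * (F.L : ℝ) ^ (K - n) * ‖(fun x => divB (torusT (F.P K) 0) (fun κ z => unitsField (toUField W) ⟨z, κ⟩) A x)‖))
    -- the windows
    (hwin1 : 1200 * max (3 / 2 * cI) (max cI c₂) * s ≤ 1)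
    (hwin2 : max (3 / 2 * cI) (max cI c₂) * (400 * (1 + 3)) * (7 * max (3 / 2 * cI) (max cI c₂) * s + s) ≤ 1 / 2) :
    ∃ Y : GaugeField (F.P K) 0 (Matrix.specialUnitaryGroup (Fin 2) ℂ), Y ∈ regFibrePr F n K h e V ∧ wilsonAction4 W' = wilsonAction4 Y ∧
      (∀ b : PBond (F.P K) 0, ‖((Y b * (W b)⁻¹ : Matrix.specialUnitaryGroup (Fin 2) ℂ) : Matrix (Fin 2) (Fin 2) ℂ) - 1‖
        ≤ (2 * s + 6 * max (3 / 2 * cI) (max cI c₂) * s) * ((F.L : ℝ) ^ (K - n))⁻¹) ∧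
      (∀ x : Site (F.P K) 0, x ∉ Set.range (embIter (K - n)) →
        divB (torusT (F.P K) 0) (fun κ z => unitsField (toUField W) ⟨z, κ⟩)
          (fun μ z => covD (torusT (F.P K) 0) (fun κ z => unitsField (toUField W) ⟨z, κ⟩) μ
            (fun y => divB (torusT (F.P K) 0) (fun κ z => unitsField (toUField W) ⟨z, κ⟩)
              (fun κ z => Complex.I • ((-Complex.I) • mlog ((Y ⟨z, κ⟩ * (W ⟨z, κ⟩)⁻¹ : Matrix.specialUnitaryGroup (Fin 2) ℂ) : Matrix (Fin 2) (Fin 2) ℂ))) y) z) x = 0) := by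
  classical
  letI : CStarAlgebra (Matrix (Fin 2) (Fin 2) ℂ) := B10Eq29TubeLine.cstarAlgebraMatrix 2
  letI : NormedAlgebra ℚ (Matrix (Fin 2) (Fin 2) ℂ) := NormedAlgebra.restrictScalars ℚ ℂ (Matrix (Fin 2) (Fin 2) ℂ)
  -- letters
  set T : Fin (F.P K).d → Equiv.Perm (Site (F.P K) 0) := torusT (F.P K) 0 with hTdef
  set U : Fin (F.P K).d → Site (F.P K) 0 → (Matrix (Fin 2) (Fin 2) ℂ)ˣ := fun κ z => unitsField (toUField W) ⟨z, κ⟩ with hUdef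
  set ℓ : ℝ := (F.L : ℝ) ^ (K - n) with hℓdef
  set C_L : ℝ := max (3 / 2 * cI) (max cI c₂) with hCLdef
  have hCL : 0 ≤ C_L := (hcI.trans (le_max_left _ _)).trans (le_max_right _ _)
  have hL1 : 1 ≤ F.L := le_of_lt F.hL.2
  have hℓ1 : (1 : ℝ) ≤ ℓ := by rw [hℓdef]; exact_mod_cast Nat.one_le_pow _ _ (by omega)
  have hℓ0 : (0 : ℝ) < ℓ := by linarith
  have hs0 : 0 ≤ s := (mul_nonneg hℓ0.le (norm_nonneg _)).trans (hEβ 0 default)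
  -- the chart data `E`, the datum `D := (−I)•mlog E`, the remainder `Nf`
  set En : Fin (F.P K).d → Site (F.P K) 0 → Matrix (Fin 2) (Fin 2) ℂ :=
    fun μ y => ((X ⟨y, μ⟩ * (W ⟨y, μ⟩)⁻¹ : Matrix.specialUnitaryGroup (Fin 2) ℂ) : Matrix (Fin 2) (Fin 2) ℂ) with hEndef
  have hEn : ∀ (μ : Fin (F.P K).d) (y : Site (F.P K) 0), En μ y ∈ Matrix.specialUnitaryGroup (Fin 2) ℂ := fun μ y => (X ⟨y, μ⟩ * (W ⟨y, μ⟩)⁻¹).2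
  set D : Fin (F.P K).d → Site (F.P K) 0 → Matrix (Fin 2) (Fin 2) ℂ := fun μ y => (-Complex.I) • mlog (En μ y) with hDdef
  set Nf : (Site (F.P K) 0 → Matrix (Fin 2) (Fin 2) ℂ) → (Fin (F.P K).d → Site (F.P K) 0 → Matrix (Fin 2) (Fin 2) ℂ) :=
    fun ψ μ y => (-Complex.I) • (mlog (exp (Complex.I • ψ y) * En μ y * star (R (U μ y) (exp (Complex.I • ψ (T μ y))))) - mlog (En μ y)
      + Complex.I • covD T U μ ψ y) with hNfdef
  have hNf : ∀ ψ (μ : Fin (F.P K).d) (y : Site (F.P K) 0), Nf ψ μ y = (-Complex.I) • (mlog (exp (Complex.I • ψ y) * En μ y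
      * star (R (unitsField (toUField W) ⟨y, μ⟩) (exp (Complex.I • ψ (torusT (F.P K) 0 μ y))))) - mlog (En μ y)
      + Complex.I • covD (torusT (F.P K) 0) (fun κ z => unitsField (toUField W) ⟨z, κ⟩) μ ψ y) := fun ψ μ y => rfl
  -- the weight letter `T₂`, the gauge `p`, the size `q`
  set T₂ : (Site (F.P K) 0 → Matrix (Fin 2) (Fin 2) ℂ) → (Site (F.P K) 0 → Matrix (Fin 2) (Fin 2) ℂ) :=
    fun ψ x => ((min (d x : ℝ) ℓ : ℝ) : ℂ) • divB T U (fun μ y => (-Complex.I) • covD T U μ ψ y) x with hT₂def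
  set p : (Site (F.P K) 0 → Matrix (Fin 2) (Fin 2) ℂ) → ℝ := fun ψ => max ‖ψ‖ (max (ℓ * ‖(fun μ z => covD T U μ ψ z)‖) (ℓ * ‖T₂ ψ‖)) with hpdef
  set q : (Fin (F.P K).d → Site (F.P K) 0 → Matrix (Fin 2) (Fin 2) ℂ) → ℝ := fun A => max (ℓ * ‖A‖) (ℓ ^ 2 * ‖(fun x => divB T U A x)‖) with hqdef
  have hp : ∀ ψ, p ψ = max ‖ψ‖ (max (ℓ * ‖(fun μ z => covD T U μ ψ z)‖) (ℓ * ‖T₂ ψ‖)) := fun ψ => rfl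
  have hq : ∀ A, ℓ ^ 2 * ‖(fun x => divB T U A x)‖ ≤ q A := fun A => le_max_right _ _
  have hIc : ‖Complex.I‖ ≤ 1 := by rw [Complex.norm_I]
  have hT₂sub : ∀ a b, T₂ (a - b) = T₂ a - T₂ b := fun a b => T₂_sub F K n W d Complex.I a b
  have hT₂le : ∀ ψ, ‖T₂ ψ‖ ≤ ℓ * 12 * ‖ψ‖ := fun ψ => norm_T₂_le F K n W d hIc ψ
  -- THE MEMBER DOOR
  obtain ⟨I, L, hI, hLchar, hLC, hLex, hHerm, hTr, hdoor⟩ :=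
    exists_exact_corrector_member' F K n W T₂ hT₂sub hT₂le p hp q hq
  obtain ⟨hK, hK₂⟩ := hKrows I L hLchar hLC (fun φ x hx => (hI φ).1.2 x hx)
  -- the rows of the datum and of the remainder
  have hN0 : Nf 0 = 0 := hN0_member F K W Complex.I En Nf hNf
  have hB : 400 * (3 * C_L * s) ≤ 1 := by nlinarith
  have hNrow : ∀ ψ ψ', ψ ∈ {ψ : Site (F.P K) 0 → Matrix (Fin 2) (Fin 2) ℂ | (∀ c ∈ Set.range (embIter (K - n)), ψ c = 0) ∧ ∀ x, (ψ x)ᴴ = ψ x ∧ (ψ x).trace = 0} →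
      ψ' ∈ {ψ : Site (F.P K) 0 → Matrix (Fin 2) (Fin 2) ℂ | (∀ c ∈ Set.range (embIter (K - n)), ψ c = 0) ∧ ∀ x, (ψ x)ᴴ = ψ x ∧ (ψ x).trace = 0} →
      p ψ ≤ 3 * C_L * s → p ψ' ≤ 3 * C_L * s → q (Nf ψ - Nf ψ') ≤ 400 * (1 + 3) * (p ψ + p ψ' + s) * p (ψ - ψ') :=
    fun ψ ψ' hψS hψ'S hψB hψ'B =>
      hN_member F K n W d hd hIc star_I' En hE1 hEβ hEdiv hs40 p hp Nf hNf hB ψ ψ' hψS hψ'S hψB hψ'B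
  have hEreal : ∀ (μ : Fin (F.P K).d) (y : Site (F.P K) 0), star (mlog (En μ y)) = -mlog (En μ y) ∧ (mlog (En μ y)).trace = 0 := by
    intro μ y
    have hβ : ‖mlog (En μ y)‖ ≤ 1 / 40 := by
      have h1 : ‖mlog (En μ y)‖ ≤ s / ℓ := by rw [le_div_iff₀ hℓ0, mul_comm]; exact hEβ μ y
      exact h1.trans (by rw [div_le_iff₀ hℓ0]; linarith)
    have hU1 := unitsField_toUField_norm_le_one W ⟨y, μ⟩
    have hUsu : ((U μ y : (Matrix (Fin 2) (Fin 2) ℂ)ˣ) : Matrix (Fin 2) (Fin 2) ℂ) ∈ Matrix.specialUnitaryGroup (Fin 2) ℂ := by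
      have e : ((U μ y : (Matrix (Fin 2) (Fin 2) ℂ)ˣ) : Matrix (Fin 2) (Fin 2) ℂ) = ((W ⟨y, μ⟩ : Matrix.specialUnitaryGroup (Fin 2) ℂ) : Matrix (Fin 2) (Fin 2) ℂ) := by
        rw [hUdef, B10Eq27TorusAxialLog.val_unitsField]; rfl
      rw [e]; exact (W ⟨y, μ⟩).2
    have h0 : (0 : Matrix (Fin 2) (Fin 2) ℂ) ∈ skewAdjoint (Matrix (Fin 2) (Fin 2) ℂ) := zero_mem _
    obtain ⟨-, -, hs, ht⟩ := skew_traceless_mlog_chartArg h0 (Matrix.trace_zero _ _) (by rw [norm_zero]; norm_num) h0 (Matrix.trace_zero _ _)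
      (by rw [norm_zero]; norm_num) (hEn μ y) (hE1 μ y) hβ hUsu hU1
    exact ⟨hs, ht⟩
  have hDreal : ∀ (μ : Fin (F.P K).d) (x : Site (F.P K) 0), (D μ x)ᴴ = D μ x ∧ (D μ x).trace = 0 := fun μ x =>
    hermitian_traceless_negI_smul (hEreal μ x).1 (hEreal μ x).2
  have hNreal := hNreal_member_row F K n W hIc star_I' En hEn hE1 hEβ hs40 Nf hNf p (fun ψ => gauge_norm_le p _ T₂ ℓ ℓ hp ψ)
    (C := C_L) (s' := s) (by nlinarith)
  have hnI : ‖(-Complex.I)‖ = 1 := by rw [norm_neg, Complex.norm_I]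
  have hDq : q D ≤ s := by
    refine max_le ?_ ?_
    · have hsup : ‖D‖ ≤ s / ℓ := by
        refine (pi_norm_le_iff_of_nonneg (div_nonneg hs0 hℓ0.le)).2 fun μ => (pi_norm_le_iff_of_nonneg (div_nonneg hs0 hℓ0.le)).2 fun y => ?_
        rw [hDdef]
        show ‖(-Complex.I) • mlog (En μ y)‖ ≤ s / ℓ
        rw [norm_smul, hnI, one_mul, le_div_iff₀ hℓ0, mul_comm]; exact hEβ μ y
      calc ℓ * ‖D‖ ≤ ℓ * (s / ℓ) := mul_le_mul_of_nonneg_left hsup hℓ0.le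
        _ = s := mul_div_cancel₀ _ hℓ0.ne'
    · have hfun : D = fun μ y => (-Complex.I) • mlog (En μ y) := rfl
      have hpt : ∀ x, ℓ ^ 2 * ‖divB T U D x‖ ≤ s := fun x => by
        rw [hfun, B9Eq3117Current.divB_smul, norm_smul, hnI, one_mul]; exact hEdiv x
      have hℓ2 : (0 : ℝ) < ℓ ^ 2 := by positivity
      have hsup : ‖(fun x => divB T U D x)‖ ≤ s / ℓ ^ 2 :=
        (pi_norm_le_iff_of_nonneg (div_nonneg hs0 hℓ2.le)).2 fun x => by rw [le_div_iff₀ hℓ2, mul_comm]; exact hpt x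
      calc ℓ ^ 2 * ‖(fun x => divB T U D x)‖ ≤ ℓ ^ 2 * (s / ℓ ^ 2) := mul_le_mul_of_nonneg_left hsup hℓ2.le
        _ = s := mul_div_cancel₀ _ hℓ2.ne'
  -- THE FIXED POINT
  obtain ⟨ψ, hψS, hψB, hfix, -⟩ := hdoor cI c₂ hcI hc₂ hK hK₂ Nf D (400 * (1 + 3)) s (by norm_num) hs0 hN0 hNrow hDreal hNreal hDq hwin2
  obtain ⟨hψC, hψHT⟩ := hψS
  -- the slice reading
  obtain ⟨hψpin, hslice⟩ := slice_of_fixedPoint_T3 F K (K - n) W I L (fun φ x hx => (hI φ).1.2 x hx) hLC hLex D (Nf ψ) ψ hfix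
  -- the gauge transformation `u = e^{Iψ}` and its rows
  have hskew : ∀ z, star (Complex.I • ψ z) = -(Complex.I • ψ z) := fun z =>
    star_smul_of_hermitian star_I' (by rw [Matrix.star_eq_conjTranspose]; exact (hψHT z).1)
  have hskA : ∀ z, Complex.I • ψ z ∈ skewAdjoint (Matrix (Fin 2) (Fin 2) ℂ) := fun z => skewAdjoint.mem_iff.2 (hskew z)
  have htrA : ∀ z, (Complex.I • ψ z).trace = 0 := fun z => by rw [Matrix.trace_smul, (hψHT z).2, smul_zero]
  let u : GaugeTransf (F.P K) 0 (Matrix.specialUnitaryGroup (Fin 2) ℂ) :=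
    fun z => ⟨exp (Complex.I • ψ z), Literature.LinearAlgebra.Matrix.exp_mem_specialUnitaryGroup_of_mem_skewAdjoint (hskA z) (htrA z)⟩
  have hu_val : ∀ z, ((u z : Matrix.specialUnitaryGroup (Fin 2) ℂ) : Matrix (Fin 2) (Fin 2) ℂ) = exp (Complex.I • ψ z) := fun z => rfl
  have hupin : descTransf F n K h u = fun _ => 1 := by
    refine descTransf_eq_one_of_vanish F h u fun y => ?_
    apply Subtype.ext
    rw [hu_val, hψpin y, smul_zero, exp_zero]
    rfl
  -- sup rows: the representative's chart and the corrector's covariant difference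
  have hsupX : ∀ b : PBond (F.P K) 0, ‖pertVar W X b‖ ≤ 2 * s * ℓ⁻¹ := by
    intro b
    have hb := MatrixLog.norm_sub_one_le_exp_norm_mlog_sub_one (hE1 b.dir b.src)
    have hβ : ‖mlog (En b.dir b.src)‖ ≤ s / ℓ := by rw [le_div_iff₀ hℓ0, mul_comm]; exact hEβ b.dir b.src
    have hβ1 : s / ℓ ≤ 1 / 40 := by rw [div_le_iff₀ hℓ0]; linarith
    have h3 := Real.abs_exp_sub_one_le (x := ‖mlog (En b.dir b.src)‖) (by rw [abs_of_nonneg (norm_nonneg _)]; linarith)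
    rw [abs_of_nonneg (norm_nonneg _)] at h3
    have h4 : Real.exp ‖mlog (En b.dir b.src)‖ - 1 ≤ 2 * (s / ℓ) := by linarith [le_abs_self (Real.exp ‖mlog (En b.dir b.src)‖ - 1)]
    calc ‖pertVar W X b‖ = ‖En b.dir b.src - 1‖ := by cases b; rfl
      _ ≤ 2 * (s / ℓ) := hb.trans h4
      _ = 2 * s * ℓ⁻¹ := by rw [div_eq_mul_inv, mul_assoc]
  have hψn : ‖ψ‖ ≤ 3 * C_L * s := (gauge_norm_le p _ T₂ ℓ ℓ hp ψ).trans hψB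
  have hcov : ∀ (μ : Fin (F.P K).d) (x : Site (F.P K) 0), ‖covD T U μ ψ x‖ ≤ 3 * C_L * s / ℓ := by
    intro μ x
    have h1 : ℓ * ‖(fun μ z => covD T U μ ψ z)‖ ≤ p ψ := by rw [hp]; exact (le_max_left _ _).trans (le_max_right _ _)
    have h2 : ‖covD T U μ ψ x‖ ≤ ‖(fun μ z => covD T U μ ψ z)‖ :=
      (norm_le_pi_norm ((fun μ z => covD T U μ ψ z) μ) x).trans (norm_le_pi_norm (fun μ z => covD T U μ ψ z) μ)
    rw [le_div_iff₀ hℓ0]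
    calc ‖covD T U μ ψ x‖ * ℓ ≤ ‖(fun μ z => covD T U μ ψ z)‖ * ℓ := mul_le_mul_of_nonneg_right h2 hℓ0.le
      _ ≤ p ψ := by rw [mul_comm]; exact h1
      _ ≤ 3 * C_L * s := hψB
  have hcorr : ∀ b : PBond (F.P K) 0, ‖((u b.src : Matrix.specialUnitaryGroup (Fin 2) ℂ) : Matrix (Fin 2) (Fin 2) ℂ)
      - ((W b : Matrix.specialUnitaryGroup (Fin 2) ℂ) : Matrix (Fin 2) (Fin 2) ℂ) * ((u b.tgt : Matrix.specialUnitaryGroup (Fin 2) ℂ) : Matrix (Fin 2) (Fin 2) ℂ)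
          * star ((W b : Matrix.specialUnitaryGroup (Fin 2) ℂ) : Matrix (Fin 2) (Fin 2) ℂ)‖ ≤ 6 * C_L * s * ℓ⁻¹ := by
    intro b
    obtain ⟨x, μ⟩ := b
    have hWinv : (((U μ x)⁻¹ : (Matrix (Fin 2) (Fin 2) ℂ)ˣ) : Matrix (Fin 2) (Fin 2) ℂ) = star ((W ⟨x, μ⟩ : Matrix.specialUnitaryGroup (Fin 2) ℂ) : Matrix (Fin 2) (Fin 2) ℂ) :=
      Units.inv_eq_of_mul_eq_one_right (Unitary.mul_star_self_of_mem (unitsField_toUField_mem_unitary W μ x))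
    have hWval : ((U μ x : (Matrix (Fin 2) (Fin 2) ℂ)ˣ) : Matrix (Fin 2) (Fin 2) ℂ) = ((W ⟨x, μ⟩ : Matrix.specialUnitaryGroup (Fin 2) ℂ) : Matrix (Fin 2) (Fin 2) ℂ) := by
      rw [hUdef, B10Eq27TorusAxialLog.val_unitsField]; rfl
    -- `W e^{A′} W^* = R(U)(e^{A′}) = e^{R(U)A′}`
    have eR : ((W ⟨x, μ⟩ : Matrix.specialUnitaryGroup (Fin 2) ℂ) : Matrix (Fin 2) (Fin 2) ℂ) * exp (Complex.I • ψ (T μ x))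
        * star ((W ⟨x, μ⟩ : Matrix.specialUnitaryGroup (Fin 2) ℂ) : Matrix (Fin 2) (Fin 2) ℂ) = exp (R (U μ x) (Complex.I • ψ (T μ x))) := by
      rw [R_def, exp_units_conj, hWinv, hWval]
    have hdiff : Complex.I • ψ x - R (U μ x) (Complex.I • ψ (T μ x)) = -(Complex.I • covD T U μ ψ x) := by
      rw [covD, B9Eq39Adjoint.R_smul, smul_sub]; abel
    have hsmall : 3 * C_L * s ≤ 1 / 2 := by nlinarith
    have hn1 : ‖Complex.I • ψ x‖ ≤ 1 / 2 := by
      rw [norm_smul, Complex.norm_I, one_mul]; exact ((norm_le_pi_norm ψ x).trans hψn).trans hsmall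
    have hn2 : ‖R (U μ x) (Complex.I • ψ (T μ x))‖ ≤ 1 / 2 := by
      rw [norm_R_eq (unitsField_toUField_norm_le_one W ⟨x, μ⟩), norm_smul, Complex.norm_I, one_mul]
      exact ((norm_le_pi_norm ψ _).trans hψn).trans hsmall
    have hLip := Literature.Analysis.Complex.norm_exp_sub_exp_le (Complex.I • ψ x) (R (U μ x) (Complex.I • ψ (T μ x)))
    have hmax : Real.exp (max ‖Complex.I • ψ x‖ ‖R (U μ x) (Complex.I • ψ (T μ x))‖) ≤ 2 :=
      (Real.exp_le_exp.2 (max_le hn1 hn2)).trans exp_half_le_two.1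
    show ‖exp (Complex.I • ψ x) - ((W ⟨x, μ⟩ : Matrix.specialUnitaryGroup (Fin 2) ℂ) : Matrix (Fin 2) (Fin 2) ℂ) * exp (Complex.I • ψ (x.shift μ))
        * star ((W ⟨x, μ⟩ : Matrix.specialUnitaryGroup (Fin 2) ℂ) : Matrix (Fin 2) (Fin 2) ℂ)‖ ≤ 6 * C_L * s * ℓ⁻¹
    have eT : x.shift μ = T μ x := rfl
    rw [eT, eR]
    calc ‖exp (Complex.I • ψ x) - exp (R (U μ x) (Complex.I • ψ (T μ x)))‖
        ≤ ‖Complex.I • ψ x - R (U μ x) (Complex.I • ψ (T μ x))‖ * Real.exp (max ‖Complex.I • ψ x‖ ‖R (U μ x) (Complex.I • ψ (T μ x))‖) := hLip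
      _ ≤ (3 * C_L * s / ℓ) * 2 := by
          refine mul_le_mul ?_ hmax (Real.exp_pos _).le (by positivity)
          rw [hdiff, norm_neg, norm_smul, Complex.norm_I, one_mul]; exact hcov μ x
      _ = 6 * C_L * s * ℓ⁻¹ := by rw [div_eq_mul_inv]; ring
  -- STEP 3: the re-gauged fibre point
  obtain ⟨hYmem, hAY, hsupY⟩ := fibrePoint_rows_of_pinned_regauge F h he W W' X hX hAX u hupin hsupX hcorr
  refine ⟨GaugeField.gaugeAct u X, hYmem, hAY, fun b => ?_, fun x hx => ?_⟩
  · have hb := hsupY b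
    calc ‖((GaugeField.gaugeAct u X b * (W b)⁻¹ : Matrix.specialUnitaryGroup (Fin 2) ℂ) : Matrix (Fin 2) (Fin 2) ℂ) - 1‖
        = ‖pertVar W (GaugeField.gaugeAct u X) b‖ := rfl
      _ ≤ 2 * s * ℓ⁻¹ + 6 * C_L * s * ℓ⁻¹ := hb
      _ = (2 * s + 6 * C_L * s) * ℓ⁻¹ := by ring
  · -- the chart identity: `↑(Y_b W_b⁻¹) = e^{Iψ(z)}·E·(R(𝒰)e^{Iψ(z+κ)})^*`, hence `I•((−I)•mlog ·) = D + Nf ψ − D_𝒰ψ` bondwise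
    have hchart : ∀ (κ : Fin (F.P K).d) (z : Site (F.P K) 0),
        Complex.I • ((-Complex.I) • mlog ((GaugeField.gaugeAct u X ⟨z, κ⟩ * (W ⟨z, κ⟩)⁻¹ : Matrix.specialUnitaryGroup (Fin 2) ℂ) : Matrix (Fin 2) (Fin 2) ℂ))
          = Complex.I • ((D κ z + Nf ψ κ z) - covD T U κ ψ z) := by
      intro κ z
      have hWinv : (((U κ z)⁻¹ : (Matrix (Fin 2) (Fin 2) ℂ)ˣ) : Matrix (Fin 2) (Fin 2) ℂ) = star ((W ⟨z, κ⟩ : Matrix.specialUnitaryGroup (Fin 2) ℂ) : Matrix (Fin 2) (Fin 2) ℂ) :=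
        Units.inv_eq_of_mul_eq_one_right (Unitary.mul_star_self_of_mem (unitsField_toUField_mem_unitary W κ z))
      have hWval : ((U κ z : (Matrix (Fin 2) (Fin 2) ℂ)ˣ) : Matrix (Fin 2) (Fin 2) ℂ) = ((W ⟨z, κ⟩ : Matrix.specialUnitaryGroup (Fin 2) ℂ) : Matrix (Fin 2) (Fin 2) ℂ) := by
        rw [hUdef, B10Eq27TorusAxialLog.val_unitsField]; rfl
      have hWW : star ((W ⟨z, κ⟩ : Matrix.specialUnitaryGroup (Fin 2) ℂ) : Matrix (Fin 2) (Fin 2) ℂ) * ((W ⟨z, κ⟩ : Matrix.specialUnitaryGroup (Fin 2) ℂ) : Matrix (Fin 2) (Fin 2) ℂ) = 1 :=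
        Unitary.star_mul_self_of_mem (W ⟨z, κ⟩).2.1
      -- the product form of the re-gauged chart argument
      have harg : ((GaugeField.gaugeAct u X ⟨z, κ⟩ * (W ⟨z, κ⟩)⁻¹ : Matrix.specialUnitaryGroup (Fin 2) ℂ) : Matrix (Fin 2) (Fin 2) ℂ)
          = exp (Complex.I • ψ z) * En κ z * star (R (U κ z) (exp (Complex.I • ψ (T κ z)))) := by
        have e1 : ((GaugeField.gaugeAct u X ⟨z, κ⟩ * (W ⟨z, κ⟩)⁻¹ : Matrix.specialUnitaryGroup (Fin 2) ℂ) : Matrix (Fin 2) (Fin 2) ℂ)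
            = exp (Complex.I • ψ z) * ((X ⟨z, κ⟩ : Matrix.specialUnitaryGroup (Fin 2) ℂ) : Matrix (Fin 2) (Fin 2) ℂ)
              * star (exp (Complex.I • ψ (T κ z))) * star ((W ⟨z, κ⟩ : Matrix.specialUnitaryGroup (Fin 2) ℂ) : Matrix (Fin 2) (Fin 2) ℂ) := by
          rw [← Matrix.star_eq_inv (W ⟨z, κ⟩), Submonoid.coe_mul, Matrix.specialUnitaryGroup.coe_star, GaugeField.gaugeAct,
            ← Matrix.star_eq_inv (u _), Submonoid.coe_mul, Submonoid.coe_mul, Matrix.specialUnitaryGroup.coe_star]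
          rfl
        have e2 : En κ z = ((X ⟨z, κ⟩ : Matrix.specialUnitaryGroup (Fin 2) ℂ) : Matrix (Fin 2) (Fin 2) ℂ) * star ((W ⟨z, κ⟩ : Matrix.specialUnitaryGroup (Fin 2) ℂ) : Matrix (Fin 2) (Fin 2) ℂ) := by
          rw [hEndef]
          show ((X ⟨z, κ⟩ * (W ⟨z, κ⟩)⁻¹ : Matrix.specialUnitaryGroup (Fin 2) ℂ) : Matrix (Fin 2) (Fin 2) ℂ) = _
          rw [← Matrix.star_eq_inv (W ⟨z, κ⟩), Submonoid.coe_mul, Matrix.specialUnitaryGroup.coe_star]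
        rw [e1, e2, R_def, hWinv, hWval, star_mul, star_mul, star_star]
        -- `eˣ X e'* W* = eˣ (X W*) (W e'* W*)` using `W* W = 1`
        calc exp (Complex.I • ψ z) * ((X ⟨z, κ⟩ : Matrix.specialUnitaryGroup (Fin 2) ℂ) : Matrix (Fin 2) (Fin 2) ℂ) * star (exp (Complex.I • ψ (T κ z)))
              * star ((W ⟨z, κ⟩ : Matrix.specialUnitaryGroup (Fin 2) ℂ) : Matrix (Fin 2) (Fin 2) ℂ)
            = exp (Complex.I • ψ z) * ((X ⟨z, κ⟩ : Matrix.specialUnitaryGroup (Fin 2) ℂ) : Matrix (Fin 2) (Fin 2) ℂ)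
              * (star ((W ⟨z, κ⟩ : Matrix.specialUnitaryGroup (Fin 2) ℂ) : Matrix (Fin 2) (Fin 2) ℂ) * ((W ⟨z, κ⟩ : Matrix.specialUnitaryGroup (Fin 2) ℂ) : Matrix (Fin 2) (Fin 2) ℂ))
              * star (exp (Complex.I • ψ (T κ z))) * star ((W ⟨z, κ⟩ : Matrix.specialUnitaryGroup (Fin 2) ℂ) : Matrix (Fin 2) (Fin 2) ℂ) := by rw [hWW, mul_one]
          _ = exp (Complex.I • ψ z) * (((X ⟨z, κ⟩ : Matrix.specialUnitaryGroup (Fin 2) ℂ) : Matrix (Fin 2) (Fin 2) ℂ) * star ((W ⟨z, κ⟩ : Matrix.specialUnitaryGroup (Fin 2) ℂ) : Matrix (Fin 2) (Fin 2) ℂ))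
              * (((W ⟨z, κ⟩ : Matrix.specialUnitaryGroup (Fin 2) ℂ) : Matrix (Fin 2) (Fin 2) ℂ) * (star (exp (Complex.I • ψ (T κ z)))
                * star ((W ⟨z, κ⟩ : Matrix.specialUnitaryGroup (Fin 2) ℂ) : Matrix (Fin 2) (Fin 2) ℂ))) := by noncomm_ring
      -- now unfold `Nf` and cancel: `(−I)•mlog Q = D + Nf ψ − D_𝒰ψ`, then apply `I • ·`
      have h0 : (-Complex.I) • mlog (exp (Complex.I • ψ z) * En κ z * star (R (U κ z) (exp (Complex.I • ψ (T κ z)))))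
          = (D κ z + Nf ψ κ z) - covD T U κ ψ z := by
        rw [hNfdef, hDdef]
        simp only []
        rw [smul_add, smul_sub, smul_smul (-Complex.I) Complex.I, show (-Complex.I) * Complex.I = 1 by rw [neg_mul, Complex.I_mul_I, neg_neg], one_smul]
        abel
      rw [harg, h0]
    set A : Fin (F.P K).d → Site (F.P K) 0 → Matrix (Fin 2) (Fin 2) ℂ := fun κ z => (D κ z + Nf ψ κ z) - covD T U κ ψ z with hAdef
    have hfun : (fun κ z => Complex.I • ((-Complex.I) • mlog ((GaugeField.gaugeAct u X ⟨z, κ⟩ * (W ⟨z, κ⟩)⁻¹ : Matrix.specialUnitaryGroup (Fin 2) ℂ) : Matrix (Fin 2) (Fin 2) ℂ)))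
        = fun κ z => Complex.I • A κ z := by
      funext κ z; rw [hchart κ z]
    rw [hfun]
    exact (slice_smul U Complex.I A x).trans (by rw [hslice x hx, smul_zero])

end Member

end Summit.QuantumFields.YangMills.Theorems.Prop7PinnedSliceOfExactCorrector

end
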